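import Literature.MathematicalPhysics.QuantumFieldTheory.Balaban1983to89.T3CruxEstimates
import Literature.MathematicalPhysics.QuantumFieldTheory.Balaban1983to89.T3HeightwiseDensityBounds
import Literature.MathematicalPhysics.QuantumFieldTheory.Balaban1983to89.B10Eq41TorusHistories
import Literature.MathematicalPhysics.QuantumFieldTheory.Balaban1983to89.B10Eq71TorusLocal
import HarnessLib

/-!
# LINE g23-3 «history_resolved» — THE LARGE-HISTORY BUDGET UPᴸ∘ RESOLVED INTO ITS HISTORIES: a typed PARTITION of the fine field space by
# DISCRETE LARGE-FIELD HISTORIES `Q` (which plaquettes of which constrained level are `θBal`-large), FINITE ADDITIVITY of the restricted densities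
# over it (PROVED), the ENTROPY ROW COUNT∘ (the plaquette-entropy product `Π_e (1 + e^{−κ·p(g)²})` is bounded K-uniformly) PROVED, and
# UPᴸ∘ (and UPˢ∘) ⟸ LFT∘ = ONE 𝐑-operation bound PER HISTORY with per-plaquette small factors `e^{−κ·p(g_i)²}` —
# organ-level line on crux `UnitScaleTilt.FluctuationComparisonRegPrIntL` (stmt-QuantumFields-20520; rung R3 `T3YM3TorusStatement.YM3TorusSU2`), lens «control»

Seat `ym-r3-idea-1` (D-0145 ideator, generation g23), cell `ym3-torus`.  PUBLISHED, NOT REGISTERED (★★OWNER RULING №36 (3)).  v1.1 (§5 rung added; rows and ★ of v1 byte-unchanged).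
**HONESTY.**  Nothing of Bałaban's is asserted: the row LFT∘ below is a `sorry`d STUB (hypothesis schema), NOT proved; the entropy row COUNT∘ IS
proved (elementary, not Bałaban's); UPᴸ∘, UPˢ∘, UP∘, PERS₁∘, TUBE∘, crux 20520 and `YM3TorusSU2` are NOT proved; this is R3 on LADDER-YM — NOT
d = 4, NOT infinite volume, NOT a mass gap, NOT Clay; no summit is proved by a line.

## The control idea (lens «control»), third cut: RESOLVE THE EXIT BUDGET BY THE EXIT ITSELF

LINE g23-2 (`Lines/history_split.lean`) split the upper stability letter at the stopping event of Bałaban's small-field flow: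
UP∘ ⟸ UPˢ∘ + UPᴸ∘ with UPᴸ∘ = «the unit-law density carried by ALL histories that leave the small-field tube is bounded, K-uniformly» — one
number for the whole complement `(histGood)ᶜ`.  My GATE ASK №9 (D1) asked whether UPᴸ∘ should instead be filed HISTORY-RESOLVED.  This file does it:

* the complement of the small-history event is PARTITIONED by the DISCRETE HISTORY `Q ⊆ {(j, p) : j ≤ K − n, p ∈ Plaq(T^{(j)})}` = the exact
  set of (constrained level, plaquette) pairs at which the block-averaged field `Ū^{j}` is `θBal(K − j)`-LARGE — print's expansion of the product of
  the decompositions of unity (7) over all constrained levels ([Balaban1985UV3] (7) p.257, «Σ_{{Ω_j}}» of (41) p.266; the discrete carrier of the tree's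
  `B10Eq41TorusHistories`, whose history functional `LF` has NO BODY — here every history's term HAS a body: the restricted density `ρ^{E_Q}`);
* FINITE ADDITIVITY (PROVED, §1): `ρ^{⋃_Q E_Q}_k = Σ_Q ρ^{E_Q}_k` a.e. for pairwise disjoint measurable events, hence at the comparison height
  `heightDensity (histGood)ᶜ = Σ_Q heightDensity E_Q − heightDensity E_∅` a.e. (and `E_∅ = histGood`);
* so UPᴸ∘ follows from ONE BOUND PER HISTORY — row LFT∘: `Z_K⁻¹·heightDensity(E_Q) ≤ C · Π_{(j,p) ∈ Q} e^{−κ·p(g_{K−j})²}` a.e. (the 𝐑-operation's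
  output for the history `Q`: «we get these small factors for all plaquettes in all large field sets» p.273, (67)–(71)) — plus the ENTROPY row
  COUNT∘: `Π_{(j,p)} (1 + e^{−κ·p(g_{K−j})²}) ≤ W` uniformly in `K` (`Σ_Q Π_{e∈Q} w_e = Π_e (1 + w_e)`, Mathlib `Finset.prod_one_add`), which this file
  PROVES (§3 `historyCount`): `p(g_i) ≥ 1 + log g_i⁻¹ ≥ i·log L∕2` makes the small factor sub-Gaussian in the height `i` while level `K − i` has exactly
  `24·L^{3(m+i)}` plaquettes (lit `card_plaq_three`, `Site.card_site`) — complete the square, geometric tail.  So UPᴸ∘ ⟸ LFT∘ ALONE, and UPˢ∘ is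
  LFT∘'s `Q = ∅` instance.

The controlling quantity of this cut is the HISTORY-INDEXED MASS VECTOR `(Z⁻¹ρ^{E_Q})_Q` — the terms of (41) one by one, typed.

## What this file proves (kernel-checked, 0 sorry outside the ONE stub `stub_largeFieldTerm`)

* §0 the carrier: `LFLabel F K n := Σ j : Fin (K − n + 1), Plaq (F.P K) j` (finite), `IsLarge`, the history events `histEvent θ K n Q`, the history
  map `histOf`; `mem_histEvent_iff` (`U ∈ E_Q ↔ histOf U = Q`), `histEvent_disjoint`, `measurableSet_histEvent`, `iUnion_histEvent_eq_univ`,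
  `histGood_eq_histEvent_empty` (for `n ≤ K`), `compl_histGood_subset_iUnion_ne` ;
* §1 (generic, tree-quality; re-derived here because `Lines/*` modules are not importable): `setIntegral_resDensity`, `resDensity_union_ae`, and NEW
  `resDensity_biUnion_ae` (FINITE additivity over a `Finset` of pairwise disjoint measurable events, by induction), `resDensity_empty_ae`,
  `heightDensity_biUnion_ae`, `heightDensity_eq_sum_histories_ae` (`hD univ = Σ_Q hD E_Q` a.e.), `heightDensity_compl_histGood_ae`
  (`hD (histGood)ᶜ = Σ_Q hD E_Q − hD E_∅` a.e.);
* §2 rows UPᴸ∘, UPˢ∘ VERBATIM from LINE g23-2 (`Lines/history_split.lean` ll.263, 244; by-text docking), the NEW row (stub) LFT∘ `LargeFieldTermCan`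
  and the entropy row COUNT∘ `HistoryCountCan`, with the small factor `smallFactor L γ b₀ p₀ κ i := exp(−κ·p(g_i)²)`, `g_i = √(γL^{−i})`, `p = B10.pFun`;
* §3 ★ `historyCount : HistoryCountCan` PROVED (`lin_sub_quad_le`, `smallFactor_le_exp_neg_sq`, `pow_mul_smallFactor_le`, `sum_exp_neg_le`; `Fintype.prod_sigma`,
  `card_plaq_three`, `Site.card_site`, `Real.add_one_le_exp`, `tsum_geometric_of_lt_one`);
* §4 ★ `largeHistoryUpper_of_terms : LFT∘ → COUNT∘ → UPᴸ∘` (thresholds `max bL 1, max pL 1`, `γ₁ := min γ₁ 1`, `C := max C 0 · W`; §1 finite additivity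
  + `Finset.prod_one_add` + `Finset.powerset_univ`), ★★ `largeHistoryUpper_of_term : LFT∘ → UPᴸ∘`, ★ `smallHistoryUpper_of_term : LFT∘ → UPˢ∘`
  (`Q = ∅`), and the by-name concluders from the stub;
* §5 (v1.1, PROVED, 0 sorry) the CUT-OFF-HEIGHT RUNG: `heightDensity_self_eq` (`heightDensity F γ le_rfl S V = 1_S(V)·e^{−β_n A(V)}`, index
  bookkeeping over `n − n`), `card_mul_sq_le_wilsonAction4_of_mem_histEvent` (`|Q|·θ_n²/4 ≤ A(V)` on `E_Q`, from (11) on `SU(2)`, lit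
  `B10Eq71TorusLocal.dist1_sq_le_specialUnitaryGroup`), `β_mul_θBal_sq` (`β_n·θ_n² = p(g_n)²`), `θBal_nonneg`, ★ `largeFieldTerm_self` (LFT∘'s inner
  body at `K = n`, POINTWISE, `κ = ¼`, `C = Z_n⁻¹`) and ★ `largeFieldTerm_at_cutoff` (the same in LFT∘'s `∃ C κ, 0 < κ ∧ ∀ Q, a.e.` shape) — a
  CONSISTENCY rung inside the trivial regime (no RG step): it checks the row's currency, it is NOT a witness of weakness and NOT a piece of the
  𝐑-operation.

v1.1 (critic #465 bookkeeping, binding): LFT∘'s WEAKNESS WITNESS is recorded in the card (`Lines/history_resolved.md` §«v1.1») — the regime «clustered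
large plaquettes sharing collars», where a per-history bound with `Q`-uniform `C` can fail while the summed letter UP∘ survives.

NET EFFECT ON THE ORGAN TREE: PERS₁∘, TUBE∘ ⟸ {UP∘, LOWB∘} (g23-1 §5∕§7) ⟸ {UPˢ∘, UPᴸ∘, LOWˢ∘} (g23-2) and now {UPˢ∘, UPᴸ∘} ⟸ LFT∘ with the entropy
DISCHARGED IN THE KERNEL: the upper stability letter rests on ONE ROW PER HISTORY SHAPE — print's inductive hypothesis (41) in the tree's bodied
currency (LFT∘ is uniform in `Q`; its content is the small-field envelope off the large-field regions TIMES the 𝐑-operation's small factor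
`e^{−κp(g)²}` per large plaquette [Balaban1989LargeFieldI-II], AFTER absorbing the `e^{O(log g_j⁻¹)|Z_j|}` collar terms of (41) — the provisos
`3r₀ + 2 ≤ 2p₀`, `56 ≤ c₁b₀²` of the tree's `B10Eq41TorusHistories.largeFieldControl_torus` are where that absorption lives).
WHY LFT∘ MIGHT FAIL: the per-history bound with a CONSTANT `C` independent of `Q` requires the small-field part of each history's term to be bounded
by the same envelope as the no-exit term (UPˢ∘) on the complement of the large-field regions — print achieves this only with the collars `Z_j ⊃ P_j`
and the `R(g_j)` margins ((38)–(40) p.266), whose volume factors must be beaten by the small factors: if the tree's `θBal` window (datum profile,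
`p₀ > 2`) is too narrow relative to print's `ε₁ = g_k p(g_k)` at some level, `κ` degrades with `K`.  Killable: the instrument's FL-8 (q-profile
dichotomy) and a direct toy count (FL-9 below).

CURRENCY: «rescaled» (unit lattice `F.P n`, `scheme_β_succ`; `θBal_i` = print's `ε` at coupling `g_{K−i}`), as ruled in g23-1 v2.
-/

open MeasureTheory Filter Topology Set
open scoped ENNReal NNReal
open Literature.MathematicalPhysics.QuantumFieldTheory.Balaban1983to89
open Literature.MathematicalPhysics.QuantumFieldTheory.Balaban1983to89.T3ContinuumYM3Torus
open Literature.MathematicalPhysics.QuantumFieldTheory.Balaban1983to89.T3LevelShift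
open Literature.MathematicalPhysics.QuantumFieldTheory.Balaban1983to89.T3NestedUnitLaws
open Literature.MathematicalPhysics.QuantumFieldTheory.Balaban1983to89.T3UnitLawDensityEML
open Literature.MathematicalPhysics.QuantumFieldTheory.Balaban1983to89.T3UnitScaleTilt
open Literature.MathematicalPhysics.QuantumFieldTheory.Balaban1983to89.T3RestrictedUnitDensity
open Literature.MathematicalPhysics.QuantumFieldTheory.Balaban1983to89.T3TiltDescent
open Literature.MathematicalPhysics.QuantumFieldTheory.Balaban1983to89.T3CruxEstimates
open Literature.MathematicalPhysics.QuantumFieldTheory.Balaban1983to89.T3HeightwiseDensityBounds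
open Literature.MathematicalPhysics.QuantumFieldTheory.Balaban1983to89.Missing
open Literature.MathematicalPhysics.QuantumFieldTheory.Balaban1983to89.T4Continuum

namespace Summit.QuantumFields.YangMills.Cruxes.FluctuationComparisonRegPrIntL.HistoryResolved

/-! ## §0 The carrier: discrete large-field histories of run `K` below the comparison height `n`, and their events (a PARTITION) -/

section Carrier

variable (F : T3Family)

/-- A LARGE-FIELD LABEL of run `K` below the comparison height `n`: a constrained level `j ≤ K − n` and a positively oriented plaquette of
`T^{(j)}` (print's pairs `(j, p′)`, cf. `B10Eq41TorusHistories.cand`).  Finite. [cite: Balaban1985UV3, (41) p.266] -/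
abbrev LFLabel (K n : ℕ) : Type := Σ j : Fin (K - n + 1), Plaq (F.P K) j.val

/-- The plaquette `e = (j, p)` is `θ(K − j)`-LARGE for the fine field `U`: `dist(Ū^{j}(∂p), 1) ≥ θ(K − j)` — the large-field half of the
decomposition of unity (7) at level `j`. [cite: Balaban1985UV3, (7) p.257] -/
def IsLarge (θ : ℕ → ℝ) (K n : ℕ) (U : GaugeField (F.P K) 0 (Matrix.specialUnitaryGroup (Fin 2) ℂ)) (e : LFLabel F K n) : Prop :=
  θ (K - e.1.val) ≤ GaugeGroup.dist1 (GaugeField.plaqHol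
    (Averaging.iter (fun i => BlockAveraging.blockAvg (P := F.P K) (j := i) ℰp) e.1.val U) e.2)

/-- The HISTORY EVENT of the discrete history `Q`: the set of fine fields whose large (level, plaquette) pairs below height `n` are EXACTLY `Q`
(one term of the expansion of `Π_j (χ_j + ζ_j)` over all constrained levels, «Σ_{{Ω_j}}» of (41)). [cite: Balaban1985UV3, (7) p.257 and (41) p.266] -/
def histEvent (θ : ℕ → ℝ) (K n : ℕ) (Q : Finset (LFLabel F K n)) :
    Set (GaugeField (F.P K) 0 (Matrix.specialUnitaryGroup (Fin 2) ℂ)) :=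
  {U | ∀ e : LFLabel F K n, e ∈ Q ↔ IsLarge F θ K n U e}

open Classical in
/-- The HISTORY of a fine field: its set of large pairs below height `n`. [cite: Balaban1985UV3, (41) p.266] -/
noncomputable def histOf (θ : ℕ → ℝ) (K n : ℕ) (U : GaugeField (F.P K) 0 (Matrix.specialUnitaryGroup (Fin 2) ℂ)) :
    Finset (LFLabel F K n) :=
  Finset.univ.filter (fun e => IsLarge F θ K n U e)

variable {F}

/-- `U ∈ E_Q ↔ histOf U = Q`: the history events are the fibres of the history map. [cite: Balaban1985UV3, (41) p.266] -/
theorem mem_histEvent_iff {θ : ℕ → ℝ} {K n : ℕ} {Q : Finset (LFLabel F K n)}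
    {U : GaugeField (F.P K) 0 (Matrix.specialUnitaryGroup (Fin 2) ℂ)} :
    U ∈ histEvent F θ K n Q ↔ histOf F θ K n U = Q := by
  classical
  simp only [histEvent, mem_setOf_eq, histOf, Finset.ext_iff, Finset.mem_filter, Finset.mem_univ, true_and]
  exact ⟨fun h e => (h e).symm, fun h e => (h e).symm⟩

/-- Distinct histories have DISJOINT events. [cite: Balaban1985UV3, (41) p.266] -/
theorem histEvent_disjoint {θ : ℕ → ℝ} {K n : ℕ} {Q Q' : Finset (LFLabel F K n)} (h : Q ≠ Q') :
    Disjoint (histEvent F θ K n Q) (histEvent F θ K n Q') :=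
  Set.disjoint_left.mpr fun _ hU hU' => h ((mem_histEvent_iff.mp hU).symm.trans (mem_histEvent_iff.mp hU'))

/-- The `k`-fold printed averaging of run `K` is measurable. [cite: Balaban1987RG1, (0.4) p.253 and (0.11) p.253] -/
theorem measurable_iterAvg (F : T3Family) (K : ℕ) :
    ∀ k : ℕ, Measurable (Averaging.iter (fun i => BlockAveraging.blockAvg (P := F.P K) (j := i) ℰp) k)
  | 0 => measurable_id
  | k + 1 => (measurable_blockAvg F K k).comp (measurable_iterAvg F K k)

/-- The large-pair condition is a measurable event. [cite: Balaban1987RG1, (0.18) p.255] -/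
theorem measurableSet_isLarge (θ : ℕ → ℝ) (K n : ℕ) (e : LFLabel F K n) :
    MeasurableSet {U : GaugeField (F.P K) 0 (Matrix.specialUnitaryGroup (Fin 2) ℂ) | IsLarge F θ K n U e} :=
  measurableSet_le measurable_const
    ((RegularGaugeGroup.measurable_dist1.comp (Missing.measurable_plaqHol e.2)).comp (measurable_iterAvg F K e.1.val))

/-- History events are measurable (finite intersections of large∕small plaquette events). [cite: Balaban1987RG1, (0.18) p.255] -/
theorem measurableSet_histEvent (θ : ℕ → ℝ) (K n : ℕ) (Q : Finset (LFLabel F K n)) :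
    MeasurableSet (histEvent F θ K n Q) := by
  have hset : histEvent F θ K n Q = ⋂ e : LFLabel F K n, {U | e ∈ Q ↔ IsLarge F θ K n U e} := by
    ext U; simp [histEvent]
  rw [hset]
  refine MeasurableSet.iInter fun e => ?_
  by_cases he : e ∈ Q
  · simp only [he, true_iff]
    exact measurableSet_isLarge θ K n e
  · simp only [he, false_iff]
    exact (measurableSet_isLarge θ K n e).compl

/-- The history events COVER the space (every field has a history). [cite: Balaban1985UV3, (7) p.257] -/
theorem iUnion_histEvent_eq_univ (θ : ℕ → ℝ) (K n : ℕ) :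
    (⋃ Q ∈ (Finset.univ : Finset (Finset (LFLabel F K n))), histEvent F θ K n Q) = Set.univ := by
  ext U
  simp only [Finset.mem_univ, iUnion_true, mem_iUnion, mem_univ, iff_true]
  exact ⟨histOf F θ K n U, mem_histEvent_iff.mpr rfl⟩

/-- The EMPTY history's event is Bałaban's small-history event `histGood` (for `n ≤ K`; the tree's `histGood` constrains exactly the levels
`j` with `j + n ≤ K`). [cite: Balaban1985UV3, (7) p.257] -/
theorem histGood_eq_histEvent_empty (θ : ℕ → ℝ) {K n : ℕ} (hK : n ≤ K) :
    histGood F ℰp θ K n = histEvent F θ K n ∅ := by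
  ext U
  simp only [histGood, PlaqSmall, mem_setOf_eq, histEvent, Finset.notMem_empty, false_iff, IsLarge, not_le]
  constructor
  · intro h e
    exact h e.1.val (by have := e.1.isLt; omega) e.2
  · intro h j hj p
    exact h ⟨⟨j, by omega⟩, p⟩

/-- The complement of the small-history event is covered by the events of the NON-EMPTY histories. [cite: Balaban1985UV3, (7) p.257 and (41) p.266] -/
theorem compl_histGood_subset_iUnion_ne (θ : ℕ → ℝ) {K n : ℕ} (hK : n ≤ K) :
    (histGood F ℰp θ K n)ᶜ ⊆ ⋃ Q ∈ {Q : Finset (LFLabel F K n) | Q ≠ ∅}, histEvent F θ K n Q := by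
  intro U hU
  simp only [mem_setOf_eq, mem_iUnion, exists_prop]
  refine ⟨histOf F θ K n U, fun h0 => hU ?_, mem_histEvent_iff.mpr rfl⟩
  rw [histGood_eq_histEvent_empty θ hK]
  exact mem_histEvent_iff.mpr h0

end Carrier

/-! ## §1 FINITE ADDITIVITY of the restricted densities over a partition (PROVED, generic) -/

section Additivity

variable {F : T3Family} {γ : ℝ} {K : ℕ}

/-- `∫_A ρ^S_k dV_k = ∫ 1_{S ∩ (Ū^k)⁻¹A}·e^{−β_K A} dU` ((2)∕(6) with the test function `1_A`). [cite: Balaban1985UV3, (2) p.256 and (6) p.257] -/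
theorem setIntegral_resDensity {S : Set (GaugeField (F.P K) 0 (Matrix.specialUnitaryGroup (Fin 2) ℂ))} (hS : MeasurableSet S)
    (hγ : 0 ≤ γ) {k : ℕ} (hk : k ≤ F.m + K) {A : Set (GaugeField (F.P K) k (Matrix.specialUnitaryGroup (Fin 2) ℂ))}
    (hA : MeasurableSet A) :
    ∫ V in A, resDensity F γ K S k V ∂fieldMeasure (F.P K) k (Matrix.specialUnitaryGroup (Fin 2) ℂ) =
      ∫ U, (S ∩ Averaging.iter (fun i => BlockAveraging.blockAvg (P := F.P K) (j := i) ℰp) k ⁻¹' A).indicator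
          (boltzmann (F.P K) ((F.scheme ℰp γ).β K)) U ∂fieldMeasure (F.P K) 0 (Matrix.specialUnitaryGroup (Fin 2) ℂ) := by
  have hb : ∀ W : GaugeField (F.P K) k (Matrix.specialUnitaryGroup (Fin 2) ℂ), |A.indicator (fun _ => (1 : ℝ)) W| ≤ 1 :=
    fun W => by by_cases hW : W ∈ A <;> simp [hW]
  have key := integral_resDensity_mul F K hS hγ hk (A.indicator (fun _ => (1 : ℝ))) (measurable_const.indicator hA) ⟨1, hb⟩
  rw [← integral_indicator hA]
  have h1 : (fun V => A.indicator (resDensity F γ K S k) V) =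
      fun V => resDensity F γ K S k V * A.indicator (fun _ => (1 : ℝ)) V := by
    funext V
    by_cases hV : V ∈ A <;> simp [hV]
  rw [h1, key]
  refine integral_congr_ae (Eventually.of_forall fun U => ?_)
  by_cases hU : U ∈ S
  · by_cases hUA : Averaging.iter (fun i => BlockAveraging.blockAvg (P := F.P K) (j := i) ℰp) k U ∈ A
    · have hmem : U ∈ S ∩ Averaging.iter (fun i => BlockAveraging.blockAvg (P := F.P K) (j := i) ℰp) k ⁻¹' A := ⟨hU, hUA⟩
      simp [Set.indicator_of_mem hU, Set.indicator_of_mem hUA, Set.indicator_of_mem hmem]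
    · have hnm : U ∉ S ∩ Averaging.iter (fun i => BlockAveraging.blockAvg (P := F.P K) (j := i) ℰp) k ⁻¹' A := fun h => hUA h.2
      simp [Set.indicator_of_notMem hUA, Set.indicator_of_notMem hnm]
  · have hnm : U ∉ S ∩ Averaging.iter (fun i => BlockAveraging.blockAvg (P := F.P K) (j := i) ℰp) k ⁻¹' A := fun h => hU h.1
    simp [Set.indicator_of_notMem hU, Set.indicator_of_notMem hnm]

/-- The restricted Boltzmann weight on a measurable event is integrable against fine product Haar. [cite: Balaban1985UV3, (1) p.256] -/
theorem integrable_indicator_boltzmann (hγ : 0 ≤ γ) {E : Set (GaugeField (F.P K) 0 (Matrix.specialUnitaryGroup (Fin 2) ℂ))}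
    (hE : MeasurableSet E) :
    Integrable (E.indicator (boltzmann (F.P K) ((F.scheme ℰp γ).β K))) (fieldMeasure (F.P K) 0 (Matrix.specialUnitaryGroup (Fin 2) ℂ)) :=
  (integrable_boltzmann RegularGaugeGroup.measurable_reTr _ (F.scheme_β_nonneg ℰp hγ K)).indicator hE

/-- ADDITIVITY: `ρ^{S ∪ S'}_k = ρ^S_k + ρ^{S'}_k` a.e. for disjoint measurable events `S, S'`. [cite: Balaban1985UV3, (7) p.257] -/
theorem resDensity_union_ae {S S' : Set (GaugeField (F.P K) 0 (Matrix.specialUnitaryGroup (Fin 2) ℂ))} (hS : MeasurableSet S)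
    (hS' : MeasurableSet S') (hd : Disjoint S S') (hγ : 0 ≤ γ) {k : ℕ} (hk : k ≤ F.m + K) :
    ∀ᵐ V ∂fieldMeasure (F.P K) k (Matrix.specialUnitaryGroup (Fin 2) ℂ),
      resDensity F γ K (S ∪ S') k V = resDensity F γ K S k V + resDensity F γ K S' k V := by
  have hint := integrable_resDensity F K (hS.union hS') hγ hk
  have hintS := integrable_resDensity F K hS hγ hk
  have hintS' := integrable_resDensity F K hS' hγ hk
  have h := Integrable.ae_eq_of_forall_setIntegral_eq _ _ hint (hintS.add hintS') fun A hA _ => by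
    simp only [Pi.add_apply]
    rw [integral_add hintS.integrableOn hintS'.integrableOn, setIntegral_resDensity (hS.union hS') hγ hk hA,
      setIntegral_resDensity hS hγ hk hA, setIntegral_resDensity hS' hγ hk hA,
      ← integral_add (integrable_indicator_boltzmann hγ (hS.inter (hA.preimage (measurable_iterAvg F K k))))
        (integrable_indicator_boltzmann hγ (hS'.inter (hA.preimage (measurable_iterAvg F K k))))]
    refine integral_congr_ae (Eventually.of_forall fun U => ?_)
    have hd' : Disjoint (S ∩ Averaging.iter (fun i => BlockAveraging.blockAvg (P := F.P K) (j := i) ℰp) k ⁻¹' A)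
        (S' ∩ Averaging.iter (fun i => BlockAveraging.blockAvg (P := F.P K) (j := i) ℰp) k ⁻¹' A) :=
      hd.mono Set.inter_subset_left Set.inter_subset_left
    simp only [Set.union_inter_distrib_right, Set.indicator_union_of_disjoint hd']
  filter_upwards [h] with V hV
  simpa using hV

/-- The restricted density of the EMPTY event vanishes a.e. (`ρ^{univ} = ρ^{∅} + ρ^{univ}`). [cite: Balaban1985UV3, (7) p.257] -/
theorem resDensity_empty_ae (hγ : 0 ≤ γ) {k : ℕ} (hk : k ≤ F.m + K) :
    ∀ᵐ V ∂fieldMeasure (F.P K) k (Matrix.specialUnitaryGroup (Fin 2) ℂ),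
      resDensity F γ K (∅ : Set (GaugeField (F.P K) 0 (Matrix.specialUnitaryGroup (Fin 2) ℂ))) k V = 0 := by
  have h := resDensity_union_ae (F := F) (γ := γ) (K := K) MeasurableSet.empty
    (MeasurableSet.univ : MeasurableSet (Set.univ : Set (GaugeField (F.P K) 0 (Matrix.specialUnitaryGroup (Fin 2) ℂ))))
    disjoint_bot_left hγ hk
  rw [Set.empty_union] at h
  filter_upwards [h] with V hV
  linarith

/-- **FINITE ADDITIVITY OVER A PARTITION**: for a finite family of pairwise disjoint measurable events,
`ρ^{⋃_{i∈s} E_i}_k = Σ_{i∈s} ρ^{E_i}_k` a.e. — the expansion of (7) into the sum over histories (41), typed. [cite: Balaban1985UV3, (7) p.257 and (41) p.266] -/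
theorem resDensity_biUnion_ae {ι : Type*} (s : Finset ι)
    {E : ι → Set (GaugeField (F.P K) 0 (Matrix.specialUnitaryGroup (Fin 2) ℂ))} (hE : ∀ i, MeasurableSet (E i))
    (hd : (↑s : Set ι).PairwiseDisjoint E) (hγ : 0 ≤ γ) {k : ℕ} (hk : k ≤ F.m + K) :
    ∀ᵐ V ∂fieldMeasure (F.P K) k (Matrix.specialUnitaryGroup (Fin 2) ℂ),
      resDensity F γ K (⋃ i ∈ s, E i) k V = ∑ i ∈ s, resDensity F γ K (E i) k V := by
  classical
  induction s using Finset.induction_on with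
  | empty =>
    have h0 : (⋃ i ∈ (∅ : Finset ι), E i) = ∅ := by simp
    rw [h0]
    filter_upwards [resDensity_empty_ae (F := F) (γ := γ) (K := K) hγ hk] with V hV
    simp [hV]
  | insert a s ha ih =>
    have hd' : (↑s : Set ι).PairwiseDisjoint E := hd.subset (by simp)
    have hdisj : Disjoint (E a) (⋃ i ∈ s, E i) := by
      rw [Set.disjoint_iUnion₂_right]
      intro i hi
      exact hd (by simp) (by simp [hi]) (fun h => ha (h ▸ hi))
    have hmeas : MeasurableSet (⋃ i ∈ s, E i) := Finset.measurableSet_biUnion s fun i _ => hE i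
    filter_upwards [resDensity_union_ae (F := F) (hE a) hmeas hdisj hγ hk, ih hd'] with V hV hih
    rw [Finset.set_biUnion_insert, hV, hih, Finset.sum_insert ha]

/-- FINITE ADDITIVITY AT THE COMPARISON HEIGHT (transport along the measure-preserving level identification `fieldShift`).
[cite: Balaban1985UV3, (7) p.257 and (41) p.266] -/
theorem heightDensity_biUnion_ae {n : ℕ} (hK : n ≤ K) {ι : Type*} (s : Finset ι)
    {E : ι → Set (GaugeField (F.P K) 0 (Matrix.specialUnitaryGroup (Fin 2) ℂ))} (hE : ∀ i, MeasurableSet (E i))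
    (hd : (↑s : Set ι).PairwiseDisjoint E) (hγ : 0 ≤ γ) :
    ∀ᵐ V ∂fieldMeasure (F.P n) 0 (Matrix.specialUnitaryGroup (Fin 2) ℂ),
      heightDensity F γ hK (⋃ i ∈ s, E i) V = ∑ i ∈ s, heightDensity F γ hK (E i) V := by
  have hae := resDensity_biUnion_ae (F := F) (γ := γ) (K := K) s hE hd hγ (k := K - n) (by omega)
  have hmp := measurePreserving_fieldShift (G := Matrix.specialUnitaryGroup (Fin 2) ℂ)
    (F.sitesPerDir_eq (m := F.m) (K := K) (j := K - n) (m' := F.m) (K' := n) (j' := 0) (by omega))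
  filter_upwards [hmp.quasiMeasurePreserving.ae hae] with V hV
  exact hV

/-- **THE SUM OVER HISTORIES** (41), typed: `heightDensity univ = Σ_Q heightDensity E_Q` a.e. at the comparison height.
[cite: Balaban1985UV3, (41) p.266] -/
theorem heightDensity_eq_sum_histories_ae {n : ℕ} (hK : n ≤ K) (θ : ℕ → ℝ) (hγ : 0 ≤ γ) :
    ∀ᵐ V ∂fieldMeasure (F.P n) 0 (Matrix.specialUnitaryGroup (Fin 2) ℂ),
      heightDensity F γ hK Set.univ V = ∑ Q : Finset (LFLabel F K n), heightDensity F γ hK (histEvent F θ K n Q) V := by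
  have h := heightDensity_biUnion_ae (F := F) (γ := γ) hK (Finset.univ : Finset (Finset (LFLabel F K n)))
    (fun Q => measurableSet_histEvent θ K n Q) (fun Q _ Q' _ hne => histEvent_disjoint hne) hγ
  rw [iUnion_histEvent_eq_univ θ K n] at h
  exact h

/-- **THE LARGE-HISTORY MASS IS THE SUM OVER NON-EMPTY HISTORIES**: `heightDensity (histGood)ᶜ = Σ_Q heightDensity E_Q − heightDensity E_∅` a.e.,
with `E_∅ = histGood`. [cite: Balaban1985UV3, (7) p.257 and (41) p.266] -/
theorem heightDensity_compl_histGood_ae {n : ℕ} (hK : n ≤ K) (θ : ℕ → ℝ) (hγ : 0 ≤ γ) :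
    ∀ᵐ V ∂fieldMeasure (F.P n) 0 (Matrix.specialUnitaryGroup (Fin 2) ℂ),
      heightDensity F γ hK (histGood F ℰp θ K n)ᶜ V =
        (∑ Q : Finset (LFLabel F K n), heightDensity F γ hK (histEvent F θ K n Q) V) - heightDensity F γ hK (histEvent F θ K n ∅) V := by
  have hsplit := resDensity_union_ae (F := F) (γ := γ) (K := K) (measurableSet_histGood F ℰp measurableE_ℰp θ K n)
    (measurableSet_histGood F ℰp measurableE_ℰp θ K n).compl disjoint_compl_right hγ (k := K - n) (by omega)
  rw [Set.union_compl_self] at hsplit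
  have hmp := measurePreserving_fieldShift (G := Matrix.specialUnitaryGroup (Fin 2) ℂ)
    (F.sitesPerDir_eq (m := F.m) (K := K) (j := K - n) (m' := F.m) (K' := n) (j' := 0) (by omega))
  filter_upwards [hmp.quasiMeasurePreserving.ae hsplit, heightDensity_eq_sum_histories_ae (F := F) (γ := γ) hK θ hγ] with V hV hsum
  rw [← histGood_eq_histEvent_empty θ hK]
  have hV' : heightDensity F γ hK Set.univ V = heightDensity F γ hK (histGood F ℰp θ K n) V + heightDensity F γ hK (histGood F ℰp θ K n)ᶜ V := hV
  linarith

end Additivity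

/-! ## §2 Rows: UPᴸ∘ VERBATIM from LINE g23-2; the NEW rows LFT∘ (large-field TERM, per history) and COUNT∘ (entropy) -/

/-- ROW UPᴸ∘ (VERBATIM, g23-2 `Lines/history_split.lean` l.263): the K-uniform budget of the unit-law density carried by the complement of the
small-history event.  Hypothesis schema; NOT proved here (DERIVED below from LFT∘ + COUNT∘). [cite: Balaban1985UV3, (7) p.257 and (38)-(40) p.266] -/
def LargeHistoryUpperCan : Prop :=
  ∀ (L : ℕ), ∃ bL pL : ℝ, ∀ (b₀ p₀ : ℝ), bL ≤ b₀ → pL ≤ p₀ →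
    ∃ γ₁ : ℝ, 0 < γ₁ ∧ ∀ (F : T3Family) (γ : ℝ), F.L = L → 0 < γ → γ ≤ γ₁ →
      ∀ (n : ℕ), ∃ C : ℝ, ∀ (K : ℕ) (hK : n ≤ K),
        ∀ᵐ V ∂(fieldMeasure (F.P n) 0 (Matrix.specialUnitaryGroup (Fin 2) ℂ)),
          (partitionFn (G := Matrix.specialUnitaryGroup (Fin 2) ℂ) (F.P K) ((F.scheme ℰp γ).β K))⁻¹ *
              heightDensity F γ hK (histGood F ℰp (θBal F.L γ b₀ p₀) K n)ᶜ V ≤ C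

/-- THE SMALL FACTOR PER LARGE PLAQUETTE at height `i` (lattice spacing `L^{−i}`): `e^{−κ·p(g_i)²}` with `g_i = √(γL^{−i})` and
`p(g) = b₀(1 + log g⁻¹)^{p₀}` (tree `B10.pFun`) — print's «small factors connected with large fields regions» (pp.273–274, (67)–(71):
`exp(−c·p(g_j)²)` per plaquette of `P_j`). [cite: Balaban1985UV3, (67)-(71) pp.273-274 and (7) p.257] -/
noncomputable def smallFactor (L : ℕ) (γ b₀ p₀ κ : ℝ) (i : ℕ) : ℝ :=
  Real.exp (-(κ * (B10.pFun b₀ p₀ (Real.sqrt (γ * ((L : ℝ)⁻¹) ^ i))) ^ 2))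

theorem smallFactor_pos (L : ℕ) (γ b₀ p₀ κ : ℝ) (i : ℕ) : 0 < smallFactor L γ b₀ p₀ κ i := Real.exp_pos _

/-- ROW LFT∘ **LARGE-FIELD TERM BOUND, PER HISTORY** (the 𝐑-operation's output, [Balaban1985UV3] (38)–(40) p.266 with the small factors (67)–(71)
pp.273–274 and the collar terms `e^{O(log g_j⁻¹)|Z_j|}` of (41) absorbed; [Balaban1989LargeFieldI-II]): in the window-profile prefix of UPᴸ∘, for
every comparison height `n` there are `C` and `κ > 0` such that for EVERY run `K ≥ n` and EVERY discrete history `Q`, almost surely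
`Z_K⁻¹·heightDensity(E_Q) ≤ C · Π_{(j,p) ∈ Q} e^{−κ·p(g_{K−j})²}`.  Uniform in `Q` and `K`; `Q = ∅` is the small-history term (then the product is `1`
and the row reads as UPˢ∘ of g23-2).  Why it might fail: `C` independent of `Q` needs the small-field part of every history's term bounded by the
no-exit envelope off the collars `Z_j ⊃ P_j` with margins `R(g_j)` — the collar volume factors must be beaten by the small factors (provisos
`3r₀ + 2 ≤ 2p₀`, `56 ≤ c₁b₀²` of lit `B10Eq41TorusHistories.largeFieldControl_torus`); with the tree's datum profile `θBal` in place of print's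
`ε₁ = g_k p(g_k)` at the minimiser, `κ` may degrade in `K`.  Hypothesis schema; NOT proved.
[cite: Balaban1985UV3, (38)-(41) p.266 and (67)-(71) pp.273-274; Balaban1989LargeFieldII, (1.97)-(1.100) p.379] -/
def LargeFieldTermCan : Prop :=
  ∀ (L : ℕ), ∃ bL pL : ℝ, ∀ (b₀ p₀ : ℝ), bL ≤ b₀ → pL ≤ p₀ →
    ∃ γ₁ : ℝ, 0 < γ₁ ∧ ∀ (F : T3Family) (γ : ℝ), F.L = L → 0 < γ → γ ≤ γ₁ →
      ∀ (n : ℕ), ∃ C κ : ℝ, 0 < κ ∧ ∀ (K : ℕ) (hK : n ≤ K) (Q : Finset (LFLabel F K n)),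
        ∀ᵐ V ∂(fieldMeasure (F.P n) 0 (Matrix.specialUnitaryGroup (Fin 2) ℂ)),
          (partitionFn (G := Matrix.specialUnitaryGroup (Fin 2) ℂ) (F.P K) ((F.scheme ℰp γ).β K))⁻¹ *
              heightDensity F γ hK (histEvent F (θBal F.L γ b₀ p₀) K n Q) V ≤
            C * ∏ e ∈ Q, smallFactor F.L γ b₀ p₀ κ (K - e.1.val)

theorem stub_largeFieldTerm : LargeFieldTermCan := by
  sorry

/-- ROW UPˢ∘ (VERBATIM, g23-2 `Lines/history_split.lean` l.244): the K-uniform sup of the small-history term.  Hypothesis schema; NOT proved here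
(DERIVED below from LFT∘ at the EMPTY history). [cite: Balaban1985UV3, (7) p.257, (41) p.266 and (6) p.257] -/
def SmallHistoryUpperCan : Prop :=
  ∀ (L : ℕ), ∃ bU pU : ℝ, ∀ (b₀ p₀ : ℝ), bU ≤ b₀ → pU ≤ p₀ →
    ∃ γ₁ : ℝ, 0 < γ₁ ∧ ∀ (F : T3Family) (γ : ℝ), F.L = L → 0 < γ → γ ≤ γ₁ →
      ∀ (n : ℕ), ∃ C : ℝ, ∀ (K : ℕ) (hK : n ≤ K),
        ∀ᵐ V ∂(fieldMeasure (F.P n) 0 (Matrix.specialUnitaryGroup (Fin 2) ℂ)),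
          (partitionFn (G := Matrix.specialUnitaryGroup (Fin 2) ℂ) (F.P K) ((F.scheme ℰp γ).β K))⁻¹ *
              heightDensity F γ hK (histGood F ℰp (θBal F.L γ b₀ p₀) K n) V ≤ C

/-- ROW COUNT∘ **HISTORY ENTROPY** — ELEMENTARY and PROVED below (`historyCount`, §3; NOT Bałaban's): the product over all (level, plaquette)
pairs below height `n` of `1 + e^{−κ·p(g_{K−j})²}` is bounded uniformly in `K` (for `0 < γ ≤ 1 ≤ b₀`, `1 ≤ p₀`, `0 < κ`).
[cite: Balaban1985UV3, p.256 («|T₁^{(k)}| = (Lᵏε)^{−3}|T_ε|») and (41) p.266] -/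
def HistoryCountCan : Prop :=
  ∀ (F : T3Family) (γ b₀ p₀ κ : ℝ), 0 < γ → γ ≤ 1 → 1 ≤ b₀ → 1 ≤ p₀ → 0 < κ →
    ∀ (n : ℕ), ∃ W : ℝ, ∀ (K : ℕ), n ≤ K →
      (∏ e : LFLabel F K n, (1 + smallFactor F.L γ b₀ p₀ κ (K - e.1.val))) ≤ W

/-! ## §3 The ENTROPY ROW COUNT∘, PROVED: small factors `e^{−κp(g_i)²}` beat the plaquette count `24·L^{3(m+i)}` of height `i` -/

section Entropy

/-- `αt − βt² ≤ α²∕(4β)` (`β > 0`). [folklore] -/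
theorem lin_sub_quad_le {α β : ℝ} (hβ : 0 < β) (t : ℝ) : α * t - β * t ^ 2 ≤ α ^ 2 / (4 * β) := by
  have h : 0 ≤ β * (t - α / (2 * β)) ^ 2 := by positivity
  have h' : β * (t - α / (2 * β)) ^ 2 = β * t ^ 2 - α * t + α ^ 2 / (4 * β) := by
    field_simp
    ring
  linarith

/-- THE SMALL FACTOR IS SUB-GAUSSIAN IN THE HEIGHT: `e^{−κp(g_i)²} ≤ e^{−κ(log L∕2)²·i²}` for `γ ≤ 1 ≤ b₀`, `1 ≤ p₀` (`log g_i⁻¹ ≥ i·log L∕2`,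
`p(g) ≥ 1 + log g⁻¹`). [cite: Balaban1985UV3, (7) p.257] -/
theorem smallFactor_le_exp_neg_sq {L : ℕ} (hL : 1 < L) {γ b₀ p₀ κ : ℝ} (hγ : 0 < γ) (hγ1 : γ ≤ 1) (hb : 1 ≤ b₀)
    (hp : 1 ≤ p₀) (hκ : 0 ≤ κ) (i : ℕ) :
    smallFactor L γ b₀ p₀ κ i ≤ Real.exp (-(κ * ((Real.log L / 2) ^ 2 * (i : ℝ) ^ 2))) := by
  unfold smallFactor
  apply Real.exp_le_exp.mpr
  have hL0 : (0 : ℝ) < L := by exact_mod_cast (zero_lt_one.trans hL)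
  have hlogL : 0 ≤ Real.log L := Real.log_nonneg (by exact_mod_cast hL.le)
  have hin : 0 < γ * ((L : ℝ)⁻¹) ^ i := by positivity
  have hlog : Real.log L / 2 * i ≤ Real.log (Real.sqrt (γ * ((L : ℝ)⁻¹) ^ i))⁻¹ := by
    rw [Real.log_inv, Real.log_sqrt hin.le, Real.log_mul hγ.ne' (by positivity), Real.log_pow, Real.log_inv]
    have : Real.log γ ≤ 0 := Real.log_nonpos hγ.le hγ1
    nlinarith
  have hc0 : 0 ≤ Real.log L / 2 * i := mul_nonneg (div_nonneg hlogL two_pos.le) (Nat.cast_nonneg i)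
  have hx1 : 1 ≤ 1 + Real.log (Real.sqrt (γ * ((L : ℝ)⁻¹) ^ i))⁻¹ := by linarith
  have hp' : Real.log L / 2 * i ≤ B10.pFun b₀ p₀ (Real.sqrt (γ * ((L : ℝ)⁻¹) ^ i)) := by
    unfold B10.pFun
    set x := 1 + Real.log (Real.sqrt (γ * ((L : ℝ)⁻¹) ^ i))⁻¹ with hx
    have hxp : x ≤ x ^ p₀ := by
      calc x = x ^ (1 : ℝ) := (Real.rpow_one x).symm
        _ ≤ x ^ p₀ := Real.rpow_le_rpow_of_exponent_le hx1 hp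
    have hx0 : 0 ≤ x ^ p₀ := Real.rpow_nonneg (by linarith) _
    calc Real.log L / 2 * i ≤ x := by linarith
      _ ≤ x ^ p₀ := hxp
      _ = 1 * x ^ p₀ := (one_mul _).symm
      _ ≤ b₀ * x ^ p₀ := mul_le_mul_of_nonneg_right hb hx0
  have hsq : (Real.log L / 2) ^ 2 * (i : ℝ) ^ 2 ≤ (B10.pFun b₀ p₀ (Real.sqrt (γ * ((L : ℝ)⁻¹) ^ i))) ^ 2 := by
    rw [← mul_pow]; exact pow_le_pow_left₀ hc0 hp' 2
  nlinarith [hsq, hκ]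

/-- ONE HEIGHT: `L^{3i}·e^{−κp(g_i)²} ≤ e^{A}·e^{−i}` with `A := (3 log L + 1)²∕(4κ(log L∕2)²)` (complete the square). [folklore] -/
theorem pow_mul_smallFactor_le {L : ℕ} (hL : 1 < L) {γ b₀ p₀ κ : ℝ} (hγ : 0 < γ) (hγ1 : γ ≤ 1) (hb : 1 ≤ b₀)
    (hp : 1 ≤ p₀) (hκ : 0 < κ) (i : ℕ) :
    ((L : ℝ)) ^ (3 * i) * smallFactor L γ b₀ p₀ κ i ≤
      Real.exp ((3 * Real.log L + 1) ^ 2 / (4 * (κ * (Real.log L / 2) ^ 2))) * Real.exp (-(i : ℝ)) := by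
  have hL0 : (0 : ℝ) < L := by exact_mod_cast (zero_lt_one.trans hL)
  have hlogL : 0 < Real.log L := Real.log_pos (by exact_mod_cast hL)
  have hβ : 0 < κ * (Real.log L / 2) ^ 2 := by positivity
  have hLpow : ((L : ℝ)) ^ (3 * i) = Real.exp (((3 * i : ℕ) : ℝ) * Real.log L) := by
    rw [Real.exp_nat_mul, Real.exp_log hL0]
  rw [hLpow, ← Real.exp_add]
  calc Real.exp (((3 * i : ℕ) : ℝ) * Real.log L) * smallFactor L γ b₀ p₀ κ i
      ≤ Real.exp (((3 * i : ℕ) : ℝ) * Real.log L) * Real.exp (-(κ * ((Real.log L / 2) ^ 2 * (i : ℝ) ^ 2))) :=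
        mul_le_mul_of_nonneg_left (smallFactor_le_exp_neg_sq hL hγ hγ1 hb hp hκ.le i) (Real.exp_pos _).le
    _ = Real.exp ((3 * Real.log L) * i - (κ * (Real.log L / 2) ^ 2) * (i : ℝ) ^ 2) := by
        rw [← Real.exp_add]; push_cast; ring_nf
    _ ≤ Real.exp ((3 * Real.log L + 1) ^ 2 / (4 * (κ * (Real.log L / 2) ^ 2)) + -(i : ℝ)) := by
        apply Real.exp_le_exp.mpr
        have := lin_sub_quad_le (α := 3 * Real.log L + 1) hβ (i : ℝ)
        linarith

/-- THE GEOMETRIC TAIL over the constrained levels: `Σ_{j ≤ K−n} e^{−(K−j)} ≤ (1 − e^{−1})⁻¹`. [folklore] -/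
theorem sum_exp_neg_le (K N : ℕ) (hN : N ≤ K + 1) :
    ∑ j : Fin N, Real.exp (-((K - j.val : ℕ) : ℝ)) ≤ (1 - Real.exp (-1))⁻¹ := by
  have hr0 : 0 ≤ Real.exp (-1) := (Real.exp_pos _).le
  have hr1 : Real.exp (-1) < 1 := by
    rw [← Real.exp_zero]
    exact Real.exp_lt_exp.mpr (by norm_num)
  have hterm : ∀ m : ℕ, Real.exp (-((m : ℕ) : ℝ)) = Real.exp (-1) ^ m := fun m => by
    rw [← Real.exp_nat_mul]; ring_nf
  simp_rw [hterm]
  rw [Fin.sum_univ_eq_sum_range (fun j => Real.exp (-1) ^ (K - j)) N]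
  have hinj : Set.InjOn (fun j => K - j) ↑(Finset.range N) := by
    intro a ha b hb hab
    simp only [Finset.coe_range, Set.mem_Iio] at ha hb
    simp only at hab
    omega
  rw [← Finset.sum_image hinj]
  calc ∑ x ∈ (Finset.range N).image (fun j => K - j), Real.exp (-1) ^ x
      ≤ ∑' i : ℕ, Real.exp (-1) ^ i :=
        (summable_geometric_of_lt_one hr0 hr1).sum_le_tsum _ (fun i _ => pow_nonneg hr0 i)
    _ = (1 - Real.exp (-1))⁻¹ := tsum_geometric_of_lt_one hr0 hr1

/-- ★ **COUNT∘ PROVED**: `Π_{(j,p)} (1 + e^{−κp(g_{K−j})²}) ≤ exp(24·L^{3m}·e^{A}·(1 − e^{−1})⁻¹)` for every run `K ≥ n` — the product over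
the Σ-type is `Π_j (1 + w_{K−j})^{#Plaq(T^{(j)})}` (`Fintype.prod_sigma`), `#Plaq(T^{(j)}) = 3·(2L^{m+K−j})³` (lit `B10Eq41TorusHistories.card_plaq_three`,
`Site.card_site`), `1 + w ≤ e^{w}`, one height's bound `pow_mul_smallFactor_le` and the geometric tail.  Elementary; NOT Bałaban's.
[cite: Balaban1985UV3, p.256 and (41) p.266] -/
theorem historyCount : HistoryCountCan := by
  intro F γ b₀ p₀ κ hγ hγ1 hb hp hκ n
  refine ⟨Real.exp (24 * (F.L : ℝ) ^ (3 * F.m) *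
      Real.exp ((3 * Real.log F.L + 1) ^ 2 / (4 * (κ * (Real.log F.L / 2) ^ 2))) * (1 - Real.exp (-1))⁻¹), fun K hK => ?_⟩
  have hL : 1 < F.L := F.hL.2
  have hL0 : (0 : ℝ) < F.L := by exact_mod_cast zero_lt_one.trans hL
  set A := (3 * Real.log F.L + 1) ^ 2 / (4 * (κ * (Real.log F.L / 2) ^ 2)) with hA
  have hprod : (∏ e : LFLabel F K n, (1 + smallFactor F.L γ b₀ p₀ κ (K - e.1.val))) =
      ∏ j : Fin (K - n + 1), (1 + smallFactor F.L γ b₀ p₀ κ (K - j.val)) ^ Fintype.card (Plaq (F.P K) j.val) := by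
    rw [Fintype.prod_sigma]
    refine Finset.prod_congr rfl fun j _ => ?_
    simp only [Finset.prod_const, Finset.card_univ]
  rw [hprod]
  have hw0 : ∀ i, 0 ≤ smallFactor F.L γ b₀ p₀ κ i := fun i => (Real.exp_pos _).le
  have hfac : ∀ j : Fin (K - n + 1),
      (1 + smallFactor F.L γ b₀ p₀ κ (K - j.val)) ^ Fintype.card (Plaq (F.P K) j.val) ≤
        Real.exp ((Fintype.card (Plaq (F.P K) j.val) : ℝ) * smallFactor F.L γ b₀ p₀ κ (K - j.val)) := by
    intro j
    rw [Real.exp_nat_mul]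
    refine pow_le_pow_left₀ (by linarith [hw0 (K - j.val)]) ?_ _
    have := Real.add_one_le_exp (smallFactor F.L γ b₀ p₀ κ (K - j.val))
    linarith
  have hcard : ∀ j : Fin (K - n + 1),
      (Fintype.card (Plaq (F.P K) j.val) : ℝ) = 24 * (F.L : ℝ) ^ (3 * F.m) * (F.L : ℝ) ^ (3 * (K - j.val)) := by
    intro j
    rw [B10Eq41TorusHistories.card_plaq_three (F.P_d K) j.val, Site.card_site]
    have hs : (F.P K).sitesPerDir j.val = 2 * F.L ^ (F.m + K - j.val) := rfl
    rw [hs, F.P_d]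
    have hj : j.val ≤ K := by have := j.isLt; omega
    have hmk : F.m + K - j.val = F.m + (K - j.val) := by omega
    rw [hmk]
    push_cast
    ring
  have hterm : ∀ j : Fin (K - n + 1),
      (Fintype.card (Plaq (F.P K) j.val) : ℝ) * smallFactor F.L γ b₀ p₀ κ (K - j.val) ≤
        24 * (F.L : ℝ) ^ (3 * F.m) * (Real.exp A * Real.exp (-((K - j.val : ℕ) : ℝ))) := by
    intro j
    rw [hcard j, mul_assoc]
    exact mul_le_mul_of_nonneg_left (pow_mul_smallFactor_le hL hγ hγ1 hb hp hκ (K - j.val)) (by positivity)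
  calc ∏ j : Fin (K - n + 1), (1 + smallFactor F.L γ b₀ p₀ κ (K - j.val)) ^ Fintype.card (Plaq (F.P K) j.val)
      ≤ ∏ j : Fin (K - n + 1), Real.exp ((Fintype.card (Plaq (F.P K) j.val) : ℝ) * smallFactor F.L γ b₀ p₀ κ (K - j.val)) :=
        Finset.prod_le_prod (fun j _ => pow_nonneg (by linarith [hw0 (K - j.val)]) _) (fun j _ => hfac j)
    _ = Real.exp (∑ j : Fin (K - n + 1), (Fintype.card (Plaq (F.P K) j.val) : ℝ) * smallFactor F.L γ b₀ p₀ κ (K - j.val)) :=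
        (Real.exp_sum _ _).symm
    _ ≤ Real.exp (24 * (F.L : ℝ) ^ (3 * F.m) * Real.exp A * (1 - Real.exp (-1))⁻¹) := by
        apply Real.exp_le_exp.mpr
        calc ∑ j : Fin (K - n + 1), (Fintype.card (Plaq (F.P K) j.val) : ℝ) * smallFactor F.L γ b₀ p₀ κ (K - j.val)
            ≤ ∑ j : Fin (K - n + 1), 24 * (F.L : ℝ) ^ (3 * F.m) * (Real.exp A * Real.exp (-((K - j.val : ℕ) : ℝ))) :=
              Finset.sum_le_sum fun j _ => hterm j
          _ = 24 * (F.L : ℝ) ^ (3 * F.m) * Real.exp A * ∑ j : Fin (K - n + 1), Real.exp (-((K - j.val : ℕ) : ℝ)) := by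
              rw [Finset.mul_sum]
              refine Finset.sum_congr rfl fun j _ => ?_
              ring
          _ ≤ 24 * (F.L : ℝ) ^ (3 * F.m) * Real.exp A * (1 - Real.exp (-1))⁻¹ :=
              mul_le_mul_of_nonneg_left (sum_exp_neg_le K (K - n + 1) (by omega)) (by positivity)

end Entropy

/-! ## §4 The junctions: UPᴸ∘ ⟸ LFT∘ (+ COUNT∘, proved) and UPˢ∘ ⟸ LFT∘ at the empty history (PROVED modulo the row LFT∘) -/

/-- `Σ_Q Π_{e ∈ Q} w_e = Π_e (1 + w_e)` over ALL histories (Mathlib `Finset.prod_one_add`, `Finset.powerset_univ`). [folklore] -/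
theorem sum_prod_smallFactor_eq {F : T3Family} {K n : ℕ} (w : LFLabel F K n → ℝ) :
    ∑ Q : Finset (LFLabel F K n), ∏ e ∈ Q, w e = ∏ e : LFLabel F K n, (1 + w e) := by
  rw [Finset.prod_one_add, Finset.powerset_univ]

/-- ★ **UPᴸ∘ ⟸ LFT∘ + COUNT∘**: thresholds `(max bL 1, max pL 1)`, `γ₁ := min γ₁ 1`, `C := max C 0 · W`:
`Z⁻¹ρ^{hgᶜ} = Σ_Q Z⁻¹ρ^{E_Q} − Z⁻¹ρ^{E_∅} ≤ Σ_Q max C 0 · Π_Q w = max C 0 · Π_e (1 + w_e) ≤ max C 0 · W` a.e. (§1 finite additivity, §3 product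
identity).  CONDITIONAL on the two rows; nothing of Bałaban's is proved. [cite: Balaban1985UV3, (41) p.266 and pp.273-274] -/
theorem largeHistoryUpper_of_terms (hT : LargeFieldTermCan) (hC : HistoryCountCan) : LargeHistoryUpperCan := by
  intro L
  obtain ⟨bL, pL, hF⟩ := hT L
  refine ⟨max bL 1, max pL 1, fun b₀ p₀ hb hp => ?_⟩
  obtain ⟨γ₁, hγ₁, h1⟩ := hF b₀ p₀ ((le_max_left _ _).trans hb) ((le_max_left _ _).trans hp)
  refine ⟨min γ₁ 1, lt_min hγ₁ one_pos, fun F γ hFL hγ hγle n => ?_⟩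
  obtain ⟨C, κ, hκ, h2⟩ := h1 F γ hFL hγ (hγle.trans (min_le_left _ _)) n
  obtain ⟨W, hW⟩ := hC F γ b₀ p₀ κ hγ (hγle.trans (min_le_right _ _)) ((le_max_right _ _).trans hb)
    ((le_max_right _ _).trans hp) hκ n
  refine ⟨max C 0 * W, fun K hK => ?_⟩
  have hall : ∀ᵐ V ∂(fieldMeasure (F.P n) 0 (Matrix.specialUnitaryGroup (Fin 2) ℂ)), ∀ Q : Finset (LFLabel F K n),
      (partitionFn (G := Matrix.specialUnitaryGroup (Fin 2) ℂ) (F.P K) ((F.scheme ℰp γ).β K))⁻¹ *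
          heightDensity F γ hK (histEvent F (θBal F.L γ b₀ p₀) K n Q) V ≤
        C * ∏ e ∈ Q, smallFactor F.L γ b₀ p₀ κ (K - e.1.val) :=
    ae_all_iff.mpr fun Q => h2 K hK Q
  have hZ : 0 ≤ (partitionFn (G := Matrix.specialUnitaryGroup (Fin 2) ℂ) (F.P K) ((F.scheme ℰp γ).β K))⁻¹ :=
    inv_nonneg.mpr (partitionFn_pos' _ (F.scheme_β_nonneg ℰp hγ.le K)).le
  filter_upwards [hall, heightDensity_compl_histGood_ae (F := F) (γ := γ) hK (θBal F.L γ b₀ p₀) hγ.le] with V hV hsplit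
  have h0 : 0 ≤ heightDensity F γ hK (histEvent F (θBal F.L γ b₀ p₀) K n ∅) V := by
    unfold heightDensity; exact resDensity_nonneg F γ K _ _ _
  have hprod : ∀ Q : Finset (LFLabel F K n), 0 ≤ ∏ e ∈ Q, smallFactor F.L γ b₀ p₀ κ (K - e.1.val) :=
    fun Q => Finset.prod_nonneg fun e _ => (smallFactor_pos _ _ _ _ _ _).le
  calc (partitionFn (G := Matrix.specialUnitaryGroup (Fin 2) ℂ) (F.P K) ((F.scheme ℰp γ).β K))⁻¹ *
          heightDensity F γ hK (histGood F ℰp (θBal F.L γ b₀ p₀) K n)ᶜ V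
      ≤ (partitionFn (G := Matrix.specialUnitaryGroup (Fin 2) ℂ) (F.P K) ((F.scheme ℰp γ).β K))⁻¹ *
          ∑ Q : Finset (LFLabel F K n), heightDensity F γ hK (histEvent F (θBal F.L γ b₀ p₀) K n Q) V := by
        rw [hsplit]
        exact mul_le_mul_of_nonneg_left (sub_le_self _ h0) hZ
    _ = ∑ Q : Finset (LFLabel F K n), (partitionFn (G := Matrix.specialUnitaryGroup (Fin 2) ℂ) (F.P K) ((F.scheme ℰp γ).β K))⁻¹ *
          heightDensity F γ hK (histEvent F (θBal F.L γ b₀ p₀) K n Q) V := Finset.mul_sum _ _ _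
    _ ≤ ∑ Q : Finset (LFLabel F K n), max C 0 * ∏ e ∈ Q, smallFactor F.L γ b₀ p₀ κ (K - e.1.val) :=
        Finset.sum_le_sum fun Q _ => (hV Q).trans (mul_le_mul_of_nonneg_right (le_max_left _ _) (hprod Q))
    _ = max C 0 * ∏ e : LFLabel F K n, (1 + smallFactor F.L γ b₀ p₀ κ (K - e.1.val)) := by
        rw [← Finset.mul_sum, sum_prod_smallFactor_eq]
    _ ≤ max C 0 * W := mul_le_mul_of_nonneg_left (hW K hK) (le_max_right _ _)

/-- ★★ **UPᴸ∘ ⟸ LFT∘ ALONE** (COUNT∘ is the theorem `historyCount`).  CONDITIONAL on the row LFT∘; nothing of Bałaban's is proved.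
[cite: Balaban1985UV3, (41) p.266 and pp.273-274] -/
theorem largeHistoryUpper_of_term (hT : LargeFieldTermCan) : LargeHistoryUpperCan :=
  largeHistoryUpper_of_terms hT historyCount

/-- ★ **UPˢ∘ ⟸ LFT∘ AT THE EMPTY HISTORY** (`E_∅ = histGood`, empty product `= 1`): the small-history envelope is the `Q = ∅` instance of the
per-history row.  CONDITIONAL on LFT∘; nothing of Bałaban's is proved. [cite: Balaban1985UV3, (7) p.257 and (41) p.266] -/
theorem smallHistoryUpper_of_term (hT : LargeFieldTermCan) : SmallHistoryUpperCan := by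
  intro L
  obtain ⟨bL, pL, hF⟩ := hT L
  refine ⟨bL, pL, fun b₀ p₀ hb hp => ?_⟩
  obtain ⟨γ₁, hγ₁, h1⟩ := hF b₀ p₀ hb hp
  refine ⟨γ₁, hγ₁, fun F γ hFL hγ hγle n => ?_⟩
  obtain ⟨C, κ, _, h2⟩ := h1 F γ hFL hγ hγle n
  refine ⟨C, fun K hK => ?_⟩
  filter_upwards [h2 K hK ∅] with V hV
  rw [histGood_eq_histEvent_empty (θBal F.L γ b₀ p₀) hK]
  simpa using hV


/-! ## §5 RUNG (PROVED, 0 sorry): LFT∘'s body AT THE CUT-OFF HEIGHT `K = n`, with `κ = ¼` and `C = Z_n⁻¹`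

At `K = n` no averaging has happened: `heightDensity F γ le_rfl E V = 1_E(V)·e^{−β_n A(V)}` (index bookkeeping over `n − n = 0`), every label
`e = (j, p)` has `j = 0`, and for `V ∈ E_Q` each plaquette `p` with `(0, p) ∈ Q` is `θ_n`-LARGE, so by (11) `‖U − 1‖² ≤ 2N(1 − Re tr U)` on `SU(2)`
(tree `B10Eq71TorusLocal.dist1_sq_le_specialUnitaryGroup`) it costs Wilson action `≥ ¼θ_n²`, and `β_n·θ_n² = p(g_n)²` EXACTLY (`β_n = (γL^{−n})⁻¹`,
`θ_n = g_n·p(g_n)`, `g_n² = γL^{−n}`).  Hence `Z_n⁻¹·heightDensity(E_Q)(V) ≤ Z_n⁻¹·Π_{e ∈ Q} e^{−¼p(g_n)²}` for EVERY `V` (not only a.e.) — LFT∘'s inner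
body at `K = n` with `κ = ¼` (print's (71) constant) and `C = Z_n⁻¹`.  This is a CONSISTENCY rung: it certifies that the row's currency (the DATUM-scale
profile `θBal`, the small factor `e^{−κp(g_{K−j})²}` taken at the label's height, the normalisation `Z_K⁻¹`) is dimensionally the right one; it sits
inside the regime where everything is trivial (no RG step) and is NOT a witness of weakness and NOT a piece of Bałaban's 𝐑-operation. -/

section Rung

variable {F : T3Family}

/-- At `K = n` every large-field label lives at the finest level `j = 0`. [cite: Balaban1985UV3, (41) p.266] -/
theorem LFLabel.level_eq_zero {n : ℕ} (e : LFLabel F n n) : e.1.val = 0 := by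
  have h := e.1.isLt
  omega

variable (F) in
/-- The label `(0, p)` of a finest-level plaquette at the cut-off height. [cite: Balaban1985UV3, (41) p.266] -/
def labelZero (n : ℕ) (p : Plaq (F.P n) 0) : LFLabel F n n := ⟨⟨0, by omega⟩, p⟩

theorem labelZero_injective (n : ℕ) : Function.Injective (labelZero F n) := by
  intro p q h
  simp only [labelZero, Sigma.mk.injEq, heq_eq_eq, true_and] at h
  exact h

theorem labelZero_surjective (n : ℕ) : Function.Surjective (labelZero F n) := by
  rintro ⟨⟨j, hj⟩, p⟩
  have hj0 : j = 0 := by omega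
  subst hj0
  exact ⟨p, rfl⟩

/-- `heightDensity` at the cut-off height IS the restricted Boltzmann weight: `ρ^{S}_{n−n}(fieldShift V) = 1_S(V)·e^{−β_n A(V)}`.
[cite: Balaban1985UV3, (2) p.256 and (41) p.266] -/
theorem heightDensity_self_eq {γ : ℝ} {n : ℕ} (S : Set (GaugeField (F.P n) 0 (Matrix.specialUnitaryGroup (Fin 2) ℂ)))
    (V : GaugeField (F.P n) 0 (Matrix.specialUnitaryGroup (Fin 2) ℂ)) :
    heightDensity F γ (le_refl n) S V = S.indicator (boltzmann (F.P n) ((F.scheme ℰp γ).β n)) V := by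
  have aux : ∀ (j : ℕ) (hj : j = 0) (e : (F.PP F.m n).sitesPerDir j = (F.PP F.m n).sitesPerDir 0),
      resDensity F γ n S j (fieldShift e V) = S.indicator (boltzmann (F.P n) ((F.scheme ℰp γ).β n)) V := by
    intro j hj e
    subst hj
    rw [fieldShift_refl]
    rfl
  exact aux (n - n) (Nat.sub_self n) _

/-- THE ACTION COST OF A HISTORY AT THE CUT-OFF HEIGHT: for `V ∈ E_Q` (all pairs of `Q` large, threshold `θ_n ≥ 0`),
`|Q|·θ_n²/4 ≤ A(V)` — each large plaquette costs `1 − Re tr V(∂p) ≥ ¼‖V(∂p) − 1‖² ≥ ¼θ_n²` by (11). [cite: Balaban1985UV3, (11) p.258 and (7) p.257] -/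
theorem card_mul_sq_le_wilsonAction4_of_mem_histEvent {θ : ℕ → ℝ} {n : ℕ} (hθ : 0 ≤ θ n) {Q : Finset (LFLabel F n n)}
    {V : GaugeField (F.P n) 0 (Matrix.specialUnitaryGroup (Fin 2) ℂ)} (hV : V ∈ histEvent F θ n n Q) :
    (Q.card : ℝ) * (θ n ^ 2 / 4) ≤ wilsonAction4 V := by
  classical
  -- the finest-level plaquettes whose label is in `Q`
  set T : Finset (Plaq (F.P n) 0) := Finset.univ.filter (fun p => labelZero F n p ∈ Q) with hT
  have hQT : Q = T.image (labelZero F n) := by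
    ext e
    simp only [hT, Finset.mem_image, Finset.mem_filter, Finset.mem_univ, true_and]
    constructor
    · intro he
      obtain ⟨p, rfl⟩ := labelZero_surjective n e
      exact ⟨p, he, rfl⟩
    · rintro ⟨p, hp, rfl⟩
      exact hp
  have hcard : Q.card = T.card := by
    rw [hQT, Finset.card_image_of_injective _ (labelZero_injective n)]
  -- each plaquette of `T` costs at least `θ_n²/4`
  have hterm : ∀ p ∈ T, θ n ^ 2 / 4 ≤ 1 - GaugeGroup.reTr (GaugeField.plaqHol V p) := by
    intro p hp
    have hpQ : labelZero F n p ∈ Q := (Finset.mem_filter.mp hp).2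
    have hl : IsLarge F θ n n V (labelZero F n p) := (hV (labelZero F n p)).mp hpQ
    have hl' : θ n ≤ GaugeGroup.dist1 (GaugeField.plaqHol V p) := by
      simpa [IsLarge, labelZero, Averaging.iter] using hl
    have h11 := B10Eq71TorusLocal.dist1_sq_le_specialUnitaryGroup (GaugeField.plaqHol V p)
    have hsq : θ n ^ 2 ≤ GaugeGroup.dist1 (GaugeField.plaqHol V p) ^ 2 := pow_le_pow_left₀ hθ hl' 2
    push_cast at h11
    linarith
  have hsum : (T.card : ℝ) * (θ n ^ 2 / 4) ≤ ∑ p ∈ T, (1 - GaugeGroup.reTr (GaugeField.plaqHol V p)) := by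
    have := Finset.card_nsmul_le_sum T (fun p => 1 - GaugeGroup.reTr (GaugeField.plaqHol V p)) (θ n ^ 2 / 4) hterm
    simpa [nsmul_eq_mul] using this
  have hsub : ∑ p ∈ T, (1 - GaugeGroup.reTr (GaugeField.plaqHol V p)) ≤ wilsonAction4 V := by
    have hle : ∑ p ∈ T, (1 - GaugeGroup.reTr (GaugeField.plaqHol V p)) ≤
        ∑ p, (1 - GaugeGroup.reTr (GaugeField.plaqHol V p)) :=
      Finset.sum_le_univ_sum_of_nonneg fun p => sub_nonneg.mpr (GaugeGroup.reTr_le_one _)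
    simpa [wilsonAction4, wilsonAction, one_mul] using hle
  rw [hcard]
  exact hsum.trans hsub

/-- `β_n·θ_n² = p(g_n)²`: the datum-scale threshold squared, in units of the inverse coupling of run `n`, IS the exponent profile.
[cite: Balaban1985UV3, (3) p.256 and (7) p.257] -/
theorem β_mul_θBal_sq (F : T3Family) {γ : ℝ} (hγ : 0 < γ) (b₀ p₀ : ℝ) (n : ℕ) :
    (F.scheme ℰp γ).β n * θBal F.L γ b₀ p₀ n ^ 2 =
      B10.pFun b₀ p₀ (Real.sqrt (γ * ((F.L : ℝ)⁻¹) ^ n)) ^ 2 := by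
  have hL : (0 : ℝ) < (F.L : ℝ) := by exact_mod_cast (lt_trans zero_lt_one F.hL.2)
  have hx : 0 < γ * ((F.L : ℝ)⁻¹) ^ n := mul_pos hγ (pow_pos (inv_pos.mpr hL) n)
  have hβ : (F.scheme ℰp γ).β n = (γ * ((F.L : ℝ)⁻¹) ^ n)⁻¹ := rfl
  rw [hβ, θBal, mul_pow, Real.sq_sqrt hx.le, ← mul_assoc, inv_mul_cancel₀ hx.ne', one_mul]

/-- At the cut-off height the threshold is nonnegative once `0 < γ ≤ 1 < L` and `0 ≤ b₀` (`g_n ≤ 1`, so `p(g_n) ≥ 0`).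
[cite: Balaban1985UV3, (7) p.257] -/
theorem θBal_nonneg (F : T3Family) {γ b₀ : ℝ} (hγ : 0 < γ) (hγ1 : γ ≤ 1) (hb : 0 ≤ b₀) (p₀ : ℝ) (n : ℕ) :
    0 ≤ θBal F.L γ b₀ p₀ n := by
  have hL1 : (1 : ℝ) < (F.L : ℝ) := by exact_mod_cast F.hL.2
  have hL : (0 : ℝ) < (F.L : ℝ) := lt_trans zero_lt_one hL1
  have hx : 0 < γ * ((F.L : ℝ)⁻¹) ^ n := mul_pos hγ (pow_pos (inv_pos.mpr hL) n)
  have hx1 : γ * ((F.L : ℝ)⁻¹) ^ n ≤ 1 :=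
    mul_le_one₀ hγ1 (pow_nonneg (inv_pos.mpr hL).le n) (pow_le_one₀ (inv_pos.mpr hL).le (inv_le_one_of_one_le₀ hL1.le))
  have hg : 0 < Real.sqrt (γ * ((F.L : ℝ)⁻¹) ^ n) := Real.sqrt_pos.mpr hx
  have hg1 : Real.sqrt (γ * ((F.L : ℝ)⁻¹) ^ n) ≤ 1 := Real.sqrt_le_one.mpr hx1
  exact mul_nonneg hg.le (B10.pFun_nonneg b₀ p₀ _ hb hg hg1)

/-- **RUNG — LFT∘ AT THE CUT-OFF HEIGHT, POINTWISE**: for every run `n`, every discrete history `Q` of run `n` below height `n` and EVERY fine field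
`V`, `Z_n⁻¹·heightDensity(E_Q)(V) ≤ Z_n⁻¹ · Π_{e ∈ Q} e^{−¼·p(g_n)²}` (the product's factor at label `e = (j, p)` is taken at height `n − j = n`).
PROVED (0 sorry); a consistency rung inside the trivial regime `K = n`, NOT a piece of the 𝐑-operation. [cite: Balaban1985UV3, (11) p.258, (7) p.257 and (71) p.274] -/
theorem largeFieldTerm_self (F : T3Family) {γ b₀ : ℝ} (p₀ : ℝ) (hγ : 0 < γ) (hγ1 : γ ≤ 1) (hb : 0 ≤ b₀) (n : ℕ)
    (Q : Finset (LFLabel F n n)) (V : GaugeField (F.P n) 0 (Matrix.specialUnitaryGroup (Fin 2) ℂ)) :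
    (partitionFn (G := Matrix.specialUnitaryGroup (Fin 2) ℂ) (F.P n) ((F.scheme ℰp γ).β n))⁻¹ *
        heightDensity F γ (le_refl n) (histEvent F (θBal F.L γ b₀ p₀) n n Q) V ≤
      (partitionFn (G := Matrix.specialUnitaryGroup (Fin 2) ℂ) (F.P n) ((F.scheme ℰp γ).β n))⁻¹ *
        ∏ e ∈ Q, smallFactor F.L γ b₀ p₀ (1 / 4) (n - e.1.val) := by
  have hZ : 0 ≤ (partitionFn (G := Matrix.specialUnitaryGroup (Fin 2) ℂ) (F.P n) ((F.scheme ℰp γ).β n))⁻¹ :=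
    inv_nonneg.mpr (partitionFn_pos' _ (F.scheme_β_nonneg ℰp hγ.le n)).le
  refine mul_le_mul_of_nonneg_left ?_ hZ
  -- the product is the `|Q|`-th power of the height-`n` factor
  have hprod : ∏ e ∈ Q, smallFactor F.L γ b₀ p₀ (1 / 4) (n - e.1.val) = smallFactor F.L γ b₀ p₀ (1 / 4) n ^ Q.card := by
    rw [← Finset.prod_const]
    refine Finset.prod_congr rfl fun e _ => ?_
    rw [LFLabel.level_eq_zero e, Nat.sub_zero]
  rw [hprod, heightDensity_self_eq]
  by_cases hV : V ∈ histEvent F (θBal F.L γ b₀ p₀) n n Q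
  · rw [Set.indicator_of_mem hV, boltzmann, smallFactor, ← Real.exp_nat_mul]
    apply Real.exp_le_exp.mpr
    have hA := card_mul_sq_le_wilsonAction4_of_mem_histEvent (θ := θBal F.L γ b₀ p₀) (θBal_nonneg F hγ hγ1 hb p₀ n) hV
    have hβ0 : 0 ≤ (F.scheme ℰp γ).β n := F.scheme_β_nonneg ℰp hγ.le n
    have hkey := β_mul_θBal_sq F hγ b₀ p₀ n
    -- `−β A ≤ −β·|Q|θ²/4 = −|Q|·p²/4`
    have h1 : (F.scheme ℰp γ).β n * ((Q.card : ℝ) * (θBal F.L γ b₀ p₀ n ^ 2 / 4)) ≤ (F.scheme ℰp γ).β n * wilsonAction4 V :=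
      mul_le_mul_of_nonneg_left hA hβ0
    have h2 : (F.scheme ℰp γ).β n * ((Q.card : ℝ) * (θBal F.L γ b₀ p₀ n ^ 2 / 4)) =
        (Q.card : ℝ) * ((1 / 4) * B10.pFun b₀ p₀ (Real.sqrt (γ * ((F.L : ℝ)⁻¹) ^ n)) ^ 2) := by
      rw [← hkey]; ring
    rw [h2] at h1
    linarith
  · rw [Set.indicator_of_notMem hV]
    exact pow_nonneg (smallFactor_pos _ _ _ _ _ _).le _

/-- **RUNG, IN LFT∘'s OWN SHAPE AT `K = n`**: `∃ C κ, 0 < κ ∧ ∀ Q, a.e. V, Z_n⁻¹·heightDensity(E_Q) ≤ C·Π_{e∈Q} smallFactor κ (n − j_e)` with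
`κ = ¼`, `C = Z_n⁻¹` — the `K = n` instance of the stub's inner body, for every `0 < γ ≤ 1`, `0 ≤ b₀`, every `p₀`. PROVED (0 sorry).
[cite: Balaban1985UV3, (11) p.258, (7) p.257 and (71) p.274] -/
theorem largeFieldTerm_at_cutoff (F : T3Family) {γ b₀ : ℝ} (p₀ : ℝ) (hγ : 0 < γ) (hγ1 : γ ≤ 1) (hb : 0 ≤ b₀) (n : ℕ) :
    ∃ C κ : ℝ, 0 < κ ∧ ∀ (Q : Finset (LFLabel F n n)),
      ∀ᵐ V ∂(fieldMeasure (F.P n) 0 (Matrix.specialUnitaryGroup (Fin 2) ℂ)),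
        (partitionFn (G := Matrix.specialUnitaryGroup (Fin 2) ℂ) (F.P n) ((F.scheme ℰp γ).β n))⁻¹ *
            heightDensity F γ (le_refl n) (histEvent F (θBal F.L γ b₀ p₀) n n Q) V ≤
          C * ∏ e ∈ Q, smallFactor F.L γ b₀ p₀ κ (n - e.1.val) :=
  ⟨_, 1 / 4, by norm_num, fun Q => Eventually.of_forall fun V => largeFieldTerm_self F p₀ hγ hγ1 hb n Q V⟩

end Rung

/-- By-name concluders: UPᴸ∘ and UPˢ∘ from the one stub (CONDITIONAL: the stub is a `sorry`d schema). -/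
theorem largeHistoryUpper_of_stubs : LargeHistoryUpperCan :=
  largeHistoryUpper_of_term stub_largeFieldTerm

theorem smallHistoryUpper_of_stubs : SmallHistoryUpperCan :=
  smallHistoryUpper_of_term stub_largeFieldTerm

end Summit.QuantumFields.YangMills.Cruxes.FluctuationComparisonRegPrIntL.HistoryResolved
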